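import Mathlib
import HarnessLib
import Summits.HubbardSuperconductivity.HubbardSuperconductivity.Theorems.KLProgrammeH10TwoPointLimitPerturbedCountBridge

/-!
# Route `KLProgramme` — crux K1 `H10TwoPointLimit` (stmt-HubbardSuperconductivity-19938):
# the two-dimensional sector count ON THE PERTURBED FERMI CURVE for given small constants (row (F) of the interface on the moving curve)

Port step (5) of HOME/prover-p4/PORT-NOTE.md §6: the lineage's `count_pairs_offset_exists` (DECOMP App. F Lemma F.1, the tree's
`count_pairs_exists` with an arbitrary offset) for the perturbed level function `h^E` of `KLProgrammePerturbedCountDefs.lean`: for constants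
`τ, λ, η₀, η₁` and perturbation sizes `κ₀, κ₁, κ₂` satisfying the five smallness conditions of the perturbed non-degeneracy lemmas
(covering `2C_g·pcE4 ≤ τ`, Cooper range `pcOdd(2λ) ≤ h_min/2` and `κ₁A_E ≤ h_min/2`, fold `pcEven ≤ h_min/2`, diagonal `pcDiag ≤ 2h_min`),
there is ONE constant `K_p` such that for EVERY `C²` even perturbation `δ` with `|δ| ≤ κ₀`, `‖Dδ‖ ≤ κ₁`, `‖D²δ‖ ≤ κ₂`, every level `μ`
with `[μ - κ₀ - η₀, μ + κ₀ + η₀] ⊂ [a, b]`, every root selection `u` of the perturbed curve `{ε₀ + δ = μ}`, every offset `P ∈ ℝ²` and every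
isotropic angular grid `N w = 2π`, `2^J w = π`, `C_δ w ≤ η₀/2`:
`#{(i, j) : |h^E_P(θ_i, θ_j)| ≤ C_δ w} ≤ K_p (J + 2 + log N)/w` (`count_pairs_perturbed_exists`). Proof = the lineage's fibration scheme verbatim
over the landed perturbed grid counts (`…PerturbedCountShift/Anti/Depth/Bridge.lean`). Everything is PROVED; no definitions.
References: BGM 2006 Lemma 3.1 / (2.76) / (2.80) / App. A2–A3 [cite: BenfattoGiulianiMastropietro2006]; HOME/prover-p4/COUNTING-NOTE.md.
-/

noncomputable section

namespace Summit.HubbardSuperconductivity.HubbardSuperconductivity.Theorems.PerturbedFermiCurve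

set_option linter.dupNamespace false -- summit = problem name (single-conjunct summit), D-0017

open Real Set
open Literature.MathematicalPhysics.QuantumLattice Literature.MathematicalPhysics.QuantumLattice.BandSectorCounting

/-- **The two-dimensional count on the perturbed Fermi curve, for given small constants** (the lineage's `count_pairs_offset_exists` on the
moving curve; DECOMP App. F Lemma F.1 = BGM (2.76)/(2.80) for all `|P_v|`, uniformly over the perturbation class). The constant `K_p` depends
on `B`, `C_δ`, `τ, λ, η₀, η₁` and the perturbation SIZES `κ₁, κ₂` only — not on `δ`, `u`, `μ`, `P`. [cite: BenfattoGiulianiMastropietro2006, Lemma 3.1] -/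
theorem count_pairs_perturbed_exists {a b : ℝ} (B : BandBounds a b) {κ₀ κ₁ κ₂ Cδ τ lam η₀ η₁ : ℝ}
    (hκ₁0 : 0 ≤ κ₁) (hκ₁ : κ₁ < B.Dtmin) (hκ₂0 : 0 ≤ κ₂)
    (hCδ : 0 < Cδ) (hτ : 0 < τ) (hτπ : τ < π) (hlam : 0 < lam) (hη₀ : 0 < η₀) (hη₁ : 0 < η₁)
    (hcov : 2 * (B.Cg * pcE4 B κ₀ κ₁ lam η₀) ≤ τ)
    (hodd : pcOdd B κ₀ κ₁ κ₂ (2 * lam) η₀ τ ≤ B.hmin / 2) (hκA : κ₁ * pcAE B κ₁ κ₂ ≤ B.hmin / 2)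
    (hfold : pcEven B κ₀ κ₁ κ₂ lam η₀ τ ≤ B.hmin / 2)
    (hH : pcDiag B κ₀ κ₁ κ₂ η₀ η₁ ≤ 2 * B.hmin) :
    ∃ Kp : ℝ, 0 < Kp ∧ ∀ δ : (Fin 2 → ℝ) → ℝ, ContDiff ℝ 2 δ → (∀ k, δ (-k) = δ k) →
      (∀ k : Fin 2 → ℝ, |δ k| ≤ κ₀) → (∀ k : Fin 2 → ℝ, ‖fderiv ℝ δ k‖ ≤ κ₁) → (∀ k : Fin 2 → ℝ, ‖fderiv ℝ (fderiv ℝ δ) k‖ ≤ κ₂) →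
      ∀ μ : ℝ, a ≤ μ - κ₀ - η₀ → μ + κ₀ + η₀ ≤ b →
      ∀ u : ℝ → ℝ, (∀ θ, IsBandFermiRadius (μ - δ (u θ • dir θ)) θ (u θ)) →
      ∀ (P : ℝ × ℝ) (w : ℝ) (N Nh J : ℕ), 0 < w → w ≤ 1 → (N : ℝ) * w = 2 * π → (Nh : ℝ) * w = π → N = 2 * Nh →
        (2 : ℝ) ^ J * w = π → Cδ * w ≤ η₀ / 2 →
        ((((Finset.range N ×ˢ Finset.range N).filter fun p : ℕ × ℕ =>
            |hfunE δ u μ P (w / 2 + p.1 * w) (w / 2 + p.2 * w)| ≤ Cδ * w).card : ℝ)) ≤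
          Kp * ((J : ℝ) + 2 + Real.log N) / w := by
  have hs := B.smax_pos; have hh := B.hmin_pos; have hCg := B.Cg_pos; have hDt := B.Dtmin_pos
  obtain ⟨-, -, -, -, hAE, hMG, hMa, hM, hA⟩ := pc_pos B hκ₁0 hκ₁ hκ₂0
  have hπ := Real.pi_pos
  -- the big constants
  obtain ⟨Kdy, hKdy⟩ : ∃ Kdy : ℝ, Kdy = 2 * Real.sqrt (Cδ / (B.hmin / 2)) *
          (2 * (32 * (4 * π / min (η₀ / (2 * pcMdiag B κ₁)) (η₁ / (4 * pcAdiag B κ₁ κ₂)) + 1) / η₁ + 16 * π / η₀) * Cδ +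
            (8 * (4 * π / min (η₀ / (2 * pcMdiag B κ₁)) (η₁ / (4 * pcAdiag B κ₁ κ₂)) + 1) / Real.sqrt (2 * B.hmin)) * Real.sqrt (2 * Cδ) +
            2 * (4 * π / min (η₀ / (2 * pcMdiag B κ₁)) (η₁ / (4 * pcAdiag B κ₁ κ₂)) + 1)) +
        (2 * (32 * (4 * π / min (η₀ / (2 * pcMdiag B κ₁)) (η₁ / (4 * pcAdiag B κ₁ κ₂)) + 1) / η₁ + 16 * π / η₀) *
            (2 * Cδ * Real.sqrt (2 * pcManti B κ₁ κ₂) / (B.hmin / 2)) * Real.sqrt (Cδ * π) +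
          Real.sqrt 2 * (8 * (4 * π / min (η₀ / (2 * pcMdiag B κ₁)) (η₁ / (4 * pcAdiag B κ₁ κ₂)) + 1) / Real.sqrt (2 * B.hmin)) *
            (2 * Cδ * Real.sqrt (2 * pcManti B κ₁ κ₂) / (B.hmin / 2)) +
          2 * (4 * π / min (η₀ / (2 * pcMdiag B κ₁)) (η₁ / (4 * pcAdiag B κ₁ κ₂)) + 1) *
            (2 * Cδ * Real.sqrt (2 * pcManti B κ₁ κ₂) / (B.hmin / 2)) / Real.sqrt Cδ) +
        8 * π * (2 * Cδ * Real.sqrt (2 * pcManti B κ₁ κ₂) / (B.hmin / 2)) / Real.sqrt (2 * Cδ * π) := ⟨_, rfl⟩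
  obtain ⟨F₅, hF₅⟩ : ∃ F₅ : ℝ, F₅ = τ / min (η₀ / (2 * pcManti B κ₁ κ₂ * τ)) (2 * lam / pcMG B κ₁ κ₂) + 1 := ⟨_, rfl⟩
  obtain ⟨C₅, hC₅⟩ : ∃ C₅ : ℝ, C₅ = 2 * π / min (η₀ / (2 * ((4 + κ₁) * pcAE B κ₁ κ₂ * τ))) (lam / pcMG B κ₁ κ₂) + 1 := ⟨_, rfl⟩
  obtain ⟨C₃', hC₃'⟩ : ∃ C₃' : ℝ, C₃' = (2 * π / (lam / (2 * pcMG B κ₁ κ₂)) + 1) * (2 * (4 * Cδ / lam + 1)) := ⟨_, rfl⟩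
  have hℓ₄ : 0 < min (η₀ / (2 * pcMdiag B κ₁)) (η₁ / (4 * pcAdiag B κ₁ κ₂)) := lt_min (by positivity) (by positivity)
  have hℓ₅ : 0 < min (η₀ / (2 * pcManti B κ₁ κ₂ * τ)) (2 * lam / pcMG B κ₁ κ₂) := lt_min (by positivity) (by positivity)
  have hKdy0 : 0 ≤ Kdy := by rw [hKdy]; positivity
  have hF₅0 : 0 ≤ F₅ := by rw [hF₅]; positivity
  have hℓO : 0 < min (η₀ / (2 * ((4 + κ₁) * pcAE B κ₁ κ₂ * τ))) (lam / pcMG B κ₁ κ₂) := lt_min (by positivity) (by positivity)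
  have hC₅0 : 0 ≤ C₅ := by rw [hC₅]; positivity
  have hC₃'0 : 0 ≤ C₃' := by rw [hC₃']; positivity
  refine ⟨4 * π * C₃' + (2 * π + 2 * (F₅ * (2 * (Kdy + 8 * π)))) +
      (2 * π + 2 * C₅ * (2 * Cδ / (B.hmin / 2) * 2 + 2 * π)), by positivity,
    fun δ hδs heven hδ hκ hκ₂ μ hlo' hhi' u hu P w N Nh J hw hw1 hN hNh hNN hJ h2δ => ?_⟩
  have hlo : a ≤ μ - κ₀ := by linarith
  have hhi : μ + κ₀ ≤ b := by linarith
  have hδη : Cδ * w ≤ η₀ := by linarith only [h2δ, hη₀]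
  have hδ0 : 0 ≤ Cδ * w := by positivity
  have hN0 : (0 : ℝ) < N := by
    have : (0:ℝ) < N * w := by rw [hN]; positivity
    exact pos_of_mul_pos_left this hw.le
  have hNpos : 0 < N := Nat.pos_of_ne_zero (fun h0 => by rw [h0] at hN0; simp at hN0)
  have hN1 : (1 : ℝ) ≤ N := by exact_mod_cast hNpos
  have hlog : 0 ≤ Real.log N := Real.log_nonneg hN1
  have hJ0 : (0 : ℝ) ≤ J := by positivity
  -- the three families of pairs
  set S := Finset.range N ×ˢ Finset.range N with hS
  set PP := S.filter (fun p : ℕ × ℕ => |hfunE δ u μ P (w / 2 + p.1 * w) (w / 2 + p.2 * w)| ≤ Cδ * w) with hPP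
  set P₃ := S.filter (fun p : ℕ × ℕ => |hfunE δ u μ P (w / 2 + p.1 * w) (w / 2 + p.2 * w)| ≤ Cδ * w ∧
    lam ≤ |h3E δ u P (w / 2 + p.1 * w) (w / 2 + p.2 * w)|) with hP₃
  set P₂ := S.filter (fun p : ℕ × ℕ => |hfunE δ u μ P (w / 2 + p.1 * w) (w / 2 + p.2 * w)| ≤ Cδ * w ∧
    lam ≤ |h3E δ u P (w / 2 + p.2 * w) (w / 2 + p.1 * w)|) with hP₂
  set P₀ := S.filter (fun p : ℕ × ℕ => |hfunE δ u μ P (w / 2 + p.1 * w) (w / 2 + p.2 * w)| ≤ Cδ * w ∧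
    |h3E δ u P (w / 2 + p.1 * w) (w / 2 + p.2 * w)| < lam ∧ |h3E δ u P (w / 2 + p.2 * w) (w / 2 + p.1 * w)| < lam) with hP₀
  have hsub : PP ⊆ P₃ ∪ (P₂ ∪ P₀) := by
    intro p hp
    rw [hPP, Finset.mem_filter] at hp
    rw [Finset.mem_union, Finset.mem_union, hP₃, hP₂, hP₀, Finset.mem_filter, Finset.mem_filter, Finset.mem_filter]
    by_cases h3a : lam ≤ |h3E δ u P (w / 2 + p.1 * w) (w / 2 + p.2 * w)|
    · exact Or.inl ⟨hp.1, hp.2, h3a⟩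
    · by_cases h3b : lam ≤ |h3E δ u P (w / 2 + p.2 * w) (w / 2 + p.1 * w)|
      · exact Or.inr (Or.inl ⟨hp.1, hp.2, h3b⟩)
      · exact Or.inr (Or.inr ⟨hp.1, hp.2, not_le.1 h3a, not_le.1 h3b⟩)
  have hcardP : (PP.card : ℝ) ≤ (P₃.card : ℝ) + (P₂.card : ℝ) + (P₀.card : ℝ) := by
    have e1 := Finset.card_le_card hsub
    have e2 := Finset.card_union_le P₃ (P₂ ∪ P₀)
    have e3 := Finset.card_union_le P₂ P₀
    have : PP.card ≤ P₃.card + P₂.card + P₀.card := by omega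
    exact_mod_cast this
  -- the transversal families
  have hC₃eq : (2 * π / (lam / (2 * pcMG B κ₁ κ₂)) + 1) * (2 * ((4 * (Cδ * w) / lam) / w + 1)) = C₃' := by
    rw [hC₃']; congr 2; field_simp
  have hP₃ : (P₃.card : ℝ) ≤ N * C₃' := by
    calc (P₃.card : ℝ) = ∑ i ∈ Finset.range N, ((((Finset.range N).filter fun c : ℕ =>
          |hfunE δ u μ P (w / 2 + i * w) (w / 2 + c * w)| ≤ Cδ * w ∧ lam ≤ |h3E δ u P (w / 2 + i * w) (w / 2 + c * w)|).card : ℝ)) :=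
          card_filter_prod_eq_sum N (fun i c : ℕ => |hfunE δ u μ P (w / 2 + i * w) (w / 2 + c * w)| ≤ Cδ * w ∧
            lam ≤ |h3E δ u P (w / 2 + i * w) (w / 2 + c * w)|)
      _ ≤ N * ((2 * π / (lam / (2 * pcMG B κ₁ κ₂)) + 1) * (2 * ((4 * (Cδ * w) / lam) / w + 1))) :=
          count_transversal_pc B hδs hδ hlo hhi hκ hκ₁ hκ₂ hu hw hlam hδ0 hN hMG
      _ = N * C₃' := by rw [hC₃eq]
  have hP₂ : (P₂.card : ℝ) ≤ N * C₃' := by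
    calc (P₂.card : ℝ) = ∑ c ∈ Finset.range N, ((((Finset.range N).filter fun i : ℕ =>
          |hfunE δ u μ P (w / 2 + i * w) (w / 2 + c * w)| ≤ Cδ * w ∧ lam ≤ |h3E δ u P (w / 2 + c * w) (w / 2 + i * w)|).card : ℝ)) :=
          card_filter_prod_eq_sum' N (fun i c : ℕ => |hfunE δ u μ P (w / 2 + i * w) (w / 2 + c * w)| ≤ Cδ * w ∧
            lam ≤ |h3E δ u P (w / 2 + c * w) (w / 2 + i * w)|)
      _ ≤ N * ((2 * π / (lam / (2 * pcMG B κ₁ κ₂)) + 1) * (2 * ((4 * (Cδ * w) / lam) / w + 1))) :=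
          count_transversal'_pc B hδs hδ hlo hhi hκ hκ₁ hκ₂ hu hw hlam hδ0 hN hMG
      _ = N * C₃' := by rw [hC₃eq]
  -- the family with both partials small
  set f : ℕ → ℝ := fun k => ((((Finset.range N).filter fun i : ℕ =>
      |hfunE δ u μ P (w / 2 + i * w) (w / 2 + i * w + k * w)| ≤ Cδ * w ∧
      |h3E δ u P (w / 2 + i * w) (w / 2 + i * w + k * w)| < lam ∧
      |h3E δ u P (w / 2 + i * w + k * w) (w / 2 + i * w)| < lam).card : ℝ)) with hf
  have hP₀ : (P₀.card : ℝ) ≤ ∑ k ∈ Finset.range N, f k := count_reindexE B hδs hδ hlo hhi hκ hκ₁ hu hN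
  have hf0 : ∀ k, 0 ≤ f k := fun k => by positivity
  have hsplit := sum_split_three (N := N) f (fun k : ℕ => (k : ℝ) * w ≤ τ) (fun k : ℕ => |(k : ℝ) * w - π| ≤ τ)
    (fun k : ℕ => 2 * π - τ ≤ (k : ℝ) * w) hf0 (by
      intro k hk hfk
      rw [Finset.mem_range] at hk
      have hne : ((Finset.range N).filter fun i : ℕ =>
          |hfunE δ u μ P (w / 2 + i * w) (w / 2 + i * w + k * w)| ≤ Cδ * w ∧
          |h3E δ u P (w / 2 + i * w) (w / 2 + i * w + k * w)| < lam ∧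
          |h3E δ u P (w / 2 + i * w + k * w) (w / 2 + i * w)| < lam).Nonempty := by
        rw [← Finset.card_pos]
        by_contra h0
        push Not at h0
        have : f k = 0 := by rw [hf]; dsimp only; exact_mod_cast Nat.le_zero.1 h0
        exact hfk this
      obtain ⟨i, hi⟩ := hne
      rw [Finset.mem_filter] at hi
      exact krange_pc B hδs hδ hlo hhi hκ hκ₁ hu hw hN hk hτπ hlo' hhi' hδη hcov hi.2)
  have hA' := count_even_posE (δ := δ) (u := u) (μ := μ) (P := P) (δ' := Cδ * w) (lam := lam) (τ := τ) hw (N := N)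
  have hBo : ∑ k ∈ (Finset.range N).filter (fun k : ℕ => |(k : ℝ) * w - π| ≤ τ), f k ≤
      N + 2 * C₅ * ((2 * (Cδ * w) / (B.hmin / 2 * w)) * (2 * (1 + Real.log N)) / w + N) := by
    have := count_odd_total_pc B hδs heven hδ hlo hhi hκ hκ₁ hκ₂ hu (P := P) (δ' := Cδ * w) (lam := lam) (τ := τ) hw hN hNh hNN
      (by positivity) hη₀ hlam hτ h2δ hlo' hhi' hodd hκA hAE hMG
    rw [← hC₅] at this
    exact this
  have hC' := count_even_negE B hδs hδ hlo hhi hκ hκ₁ hu (P := P) (δ' := Cδ * w) (lam := lam) (τ := τ) hw hN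
  have hE : ∑ s ∈ Finset.range (4 * N), ((((Finset.range ⌊τ / w⌋₊).filter fun i : ℕ =>
      |hfunE δ u μ P (w / 2 + s * (w / 2) - (w + i * w) / 2) (w / 2 + s * (w / 2) + (w + i * w) / 2)| ≤ Cδ * w ∧
      |h3E δ u P (w / 2 + s * (w / 2) + (w + i * w) / 2) (w / 2 + s * (w / 2) - (w + i * w) / 2) +
          h3E δ u P (w / 2 + s * (w / 2) - (w + i * w) / 2) (w / 2 + s * (w / 2) + (w + i * w) / 2)| ≤ 2 * lam).card : ℝ)) ≤ F₅ * (2 * (((J : ℝ) + 1) * Kdy / w + 4 * N)) := by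
    have := count_anti_total_pc B hδs hδ hlo hhi hκ hκ₁ hκ₂ hu (P := P) hw hw1 hN hJ hCδ hlam hτ hη₀ hη₁ h2δ hlo' hhi' hfold hH hMa hMG hM hA
    rw [← hKdy, ← hF₅] at this
    exact this
  clear hKdy hF₅ hC₅ hC₃' hC₃eq
  -- abbreviate the logarithm and the sums, and use `N = 2π/w`
  set lg := Real.log (N : ℝ) with hlg
  set L := (J : ℝ) + 2 + lg with hL
  have hL1 : 1 ≤ L := by rw [hL]; linarith only [hlog, hJ0]
  have hNw : (N : ℝ) = 2 * π / w := by field_simp; linarith only [hN]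
  set EE := ∑ s ∈ Finset.range (4 * N), ((((Finset.range ⌊τ / w⌋₊).filter fun i : ℕ =>
      |hfunE δ u μ P (w / 2 + s * (w / 2) - (w + i * w) / 2) (w / 2 + s * (w / 2) + (w + i * w) / 2)| ≤ Cδ * w ∧
      |h3E δ u P (w / 2 + s * (w / 2) + (w + i * w) / 2) (w / 2 + s * (w / 2) - (w + i * w) / 2) +
          h3E δ u P (w / 2 + s * (w / 2) - (w + i * w) / 2) (w / 2 + s * (w / 2) + (w + i * w) / 2)| ≤ 2 * lam).card : ℝ)) with hEE
  set OD := ∑ k ∈ (Finset.range N).filter (fun k : ℕ => |(k : ℝ) * w - π| ≤ τ), f k with hOD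
  have hEB : EE ≤ F₅ * (2 * (Kdy + 8 * π)) * L / w := by
    refine hE.trans ?_
    have h4N : (4 : ℝ) * N = 8 * π / w := by rw [hNw]; ring
    have key : ((J : ℝ) + 1) * Kdy + 8 * π ≤ (Kdy + 8 * π) * L := by
      rw [hL]; nlinarith only [hlog, hKdy0, hπ, hJ0]
    calc F₅ * (2 * (((J : ℝ) + 1) * Kdy / w + 4 * N)) = F₅ * (2 * ((((J : ℝ) + 1) * Kdy + 8 * π) / w)) := by
          rw [h4N, add_div]
      _ = F₅ * 2 * (((J : ℝ) + 1) * Kdy + 8 * π) / w := by ring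
      _ ≤ F₅ * 2 * ((Kdy + 8 * π) * L) / w := by gcongr
      _ = F₅ * (2 * (Kdy + 8 * π)) * L / w := by ring
  have hodd' : OD ≤ (2 * π + 2 * C₅ * (2 * Cδ / (B.hmin / 2) * 2 + 2 * π)) * L / w := by
    refine hBo.trans ?_
    have e2 : 2 * (Cδ * w) / (B.hmin / 2 * w) = 2 * Cδ / (B.hmin / 2) := by field_simp
    rw [e2, hNw]
    have t1 : 1 + lg ≤ L := by rw [hL]; linarith only [hJ0]
    have t2 : 0 ≤ 2 * Cδ / (B.hmin / 2) := by positivity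
    have key : 2 * π + 2 * C₅ * (2 * Cδ / (B.hmin / 2) * (2 * (1 + lg)) + 2 * π) ≤
        (2 * π + 2 * C₅ * (2 * Cδ / (B.hmin / 2) * 2 + 2 * π)) * L := by
      have f1 : 2 * π ≤ 2 * π * L := le_mul_of_one_le_right (by positivity) hL1
      have f2 : 2 * Cδ / (B.hmin / 2) * (2 * (1 + lg)) ≤ 2 * Cδ / (B.hmin / 2) * (2 * L) :=
        mul_le_mul_of_nonneg_left (by linarith only [t1]) t2
      have f4 : 2 * C₅ * (2 * Cδ / (B.hmin / 2) * (2 * (1 + lg)) + 2 * π) ≤ 2 * C₅ * (2 * Cδ / (B.hmin / 2) * (2 * L) + 2 * π * L) :=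
        mul_le_mul_of_nonneg_left (add_le_add f2 f1) (by positivity)
      have e : (2 * π + 2 * C₅ * (2 * Cδ / (B.hmin / 2) * 2 + 2 * π)) * L =
          2 * π * L + 2 * C₅ * (2 * Cδ / (B.hmin / 2) * (2 * L) + 2 * π * L) := by ring
      rw [e]; linarith only [f1, f4]
    calc 2 * π / w + 2 * C₅ * (2 * Cδ / (B.hmin / 2) * (2 * (1 + lg)) / w + 2 * π / w)
        = (2 * π + 2 * C₅ * (2 * Cδ / (B.hmin / 2) * (2 * (1 + lg)) + 2 * π)) / w := by
          field_simp
      _ ≤ (2 * π + 2 * C₅ * (2 * Cδ / (B.hmin / 2) * 2 + 2 * π)) * L / w :=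
          div_le_div_of_nonneg_right key hw.le
  have heven' : N + 2 * EE ≤ (2 * π + 2 * (F₅ * (2 * (Kdy + 8 * π)))) * L / w := by
    rw [hNw]
    have t : 2 * π / w ≤ 2 * π * L / w := by
      apply div_le_div_of_nonneg_right _ hw.le; nlinarith only [hL1, hπ]
    have e : (2 * π + 2 * (F₅ * (2 * (Kdy + 8 * π)))) * L / w = 2 * π * L / w + 2 * (F₅ * (2 * (Kdy + 8 * π)) * L / w) := by
      ring
    rw [e]; linarith only [t, hEB]
  have htrans' : 2 * (N * C₃') ≤ 4 * π * C₃' * L / w := by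
    rw [hNw]
    have e : 2 * (2 * π / w * C₃') = 4 * π * C₃' / w := by field_simp; ring
    rw [e]
    apply div_le_div_of_nonneg_right _ hw.le
    exact le_mul_of_one_le_right (by positivity) hL1
  -- combine
  have h0 : (P₀.card : ℝ) ≤ (2 * π + 2 * (F₅ * (2 * (Kdy + 8 * π)))) * L / w +
      (2 * π + 2 * C₅ * (2 * Cδ / (B.hmin / 2) * 2 + 2 * π)) * L / w := by
    have := hP₀.trans hsplit
    linarith only [this, hA', hC', heven', hodd', hEB]
  have e : (4 * π * C₃' + (2 * π + 2 * (F₅ * (2 * (Kdy + 8 * π)))) +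
      (2 * π + 2 * C₅ * (2 * Cδ / (B.hmin / 2) * 2 + 2 * π))) * L / w =
      4 * π * C₃' * L / w + ((2 * π + 2 * (F₅ * (2 * (Kdy + 8 * π)))) * L / w +
      (2 * π + 2 * C₅ * (2 * Cδ / (B.hmin / 2) * 2 + 2 * π)) * L / w) := by ring
  rw [e]
  linarith only [hcardP, hP₃, hP₂, htrans', h0]


end Summit.HubbardSuperconductivity.HubbardSuperconductivity.Theorems.PerturbedFermiCurve

end
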